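import Mathlib
import Summits.ResolutionOfSingularities.ResolutionOfSingularities.Theorems.WildQuotientsWildQuotientResolutionJordanFiveX0ChartTools

/-!
# RUNG V5 (`J₅`), brick `HP₀`: the root-chart automorphism at the `μ₄`-vertex exists and intertwines

(crux stmt-ResolutionOfSingularities-15640 `WildQuotients.WildQuotientResolution`, line `Sketch`;
chain w45c RUNG V5, inputs of the `HP₀` transport (`JordanFive.exists_ringBrick_X0_model` takes the
root-chart law `σ_U` ABSTRACTLY, as res-type-036's `RootChart0`/`Chart0Fixed` do); the `J₅` twins of
res-L1-w45c-stub-1's `JordanFour.exists_rootChart4Equiv` / `aeval_root0_comp_eq` (p50xxxx, V4U).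
[OURS · L1 W4.5c] — NOT a statement of any manuscript; replaces the role of no printed item.
Prover res-L1-w45c-stub-2. Def-free.)

* `exists_rootChart5Equiv` — a `k`-algebra automorphism `σ_U` of `k[x]` with `y₁ ↦ y₁ + ρ`,
  `y₂ ↦ y₂ + ρy₁`, `y₃ ↦ y₃ + ρy₂`, `y₄ ↦ y₄ + ρy₃` (slots `ρ = X a, y₁ = X b, …, y₄ = X e`), other
  variables fixed (explicit triangular inverse);
* `aeval_root5_comp_eq` — **`ψ₀ ∘ σ = σ_U ∘ ψ₀`** for the `J₅` automorphism `σ` (`x_b ↦ x_b + x_a`, …,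
  `x_e ↦ x_e + x_d`) and the root substitution `ψ₀ : x_a ↦ ρ⁴, x_b ↦ ρ³y₁, x_c ↦ ρ²y₂, x_d ↦ ρy₃`
  (both automorphisms given by their laws).
-/

-- single-problem summit: the doubled namespace component `ResolutionOfSingularities` is forced
set_option linter.dupNamespace false

noncomputable section

open MvPolynomial

namespace Summit.ResolutionOfSingularities.ResolutionOfSingularities.Theorems.WildQuotientResolution.JordanFive

variable (k : Type) [Field k] (n : ℕ) (a b c d e : Fin n)
  (hab : a ≠ b) (hac : a ≠ c) (had : a ≠ d) (hae : a ≠ e) (hbc : b ≠ c) (hbd : b ≠ d)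
  (hbe : b ≠ e) (hcd : c ≠ d) (hce : c ≠ e) (hde : d ≠ e)

include hab hac had hae hbc hbd hbe hcd hce hde in
/-- **The root-chart automorphism exists** (`μ₄` vertex chart of `J₅`): `σ_U y₁ = y₁ + ρ`,
`σ_U y₂ = y₂ + ρy₁`, `σ_U y₃ = y₃ + ρy₂`, `σ_U y₄ = y₄ + ρy₃`, `σ_U xᵢ = xᵢ` otherwise; inverse
`y₁ ↦ y₁ − ρ`, `y₂ ↦ y₂ − ρy₁ + ρ²`, `y₃ ↦ y₃ − ρy₂ + ρ²y₁ − ρ³`, `y₄ ↦ y₄ − ρy₃ + ρ²y₂ − ρ³y₁ + ρ⁴`.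
[OURS · L1 W4.5c] [folklore] -/
theorem exists_rootChart5Equiv :
    ∃ σU : MvPolynomial (Fin n) k ≃ₐ[k] MvPolynomial (Fin n) k,
      σU (X b) = X b + X a ∧ σU (X c) = X c + X a * X b ∧ σU (X d) = X d + X a * X c ∧
        σU (X e) = X e + X a * X d ∧ ∀ i, i ≠ b → i ≠ c → i ≠ d → i ≠ e → σU (X i) = X i := by
  classical
  let φ : MvPolynomial (Fin n) k →ₐ[k] MvPolynomial (Fin n) k :=
    aeval fun i => if i = b then X b + X a else if i = c then X c + X a * X b
      else if i = d then X d + X a * X c else if i = e then X e + X a * X d else X i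
  let φ' : MvPolynomial (Fin n) k →ₐ[k] MvPolynomial (Fin n) k :=
    aeval fun i => if i = b then X b - X a else if i = c then X c - X a * X b + X a ^ 2
      else if i = d then X d - X a * X c + X a ^ 2 * X b - X a ^ 3
      else if i = e then X e - X a * X d + X a ^ 2 * X c - X a ^ 3 * X b + X a ^ 4 else X i
  have hφa : φ (X a) = X a := by change aeval _ (X a) = _; rw [aeval_X]; simp [hab, hac, had, hae]
  have hφb : φ (X b) = X b + X a := by change aeval _ (X b) = _; rw [aeval_X]; simp
  have hφc : φ (X c) = X c + X a * X b := by
    change aeval _ (X c) = _; rw [aeval_X]; simp [hbc.symm]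
  have hφd : φ (X d) = X d + X a * X c := by
    change aeval _ (X d) = _; rw [aeval_X]; simp [hbd.symm, hcd.symm]
  have hφe : φ (X e) = X e + X a * X d := by
    change aeval _ (X e) = _; rw [aeval_X]; simp [hbe.symm, hce.symm, hde.symm]
  have hφi : ∀ i, i ≠ b → i ≠ c → i ≠ d → i ≠ e → φ (X i) = X i := fun i h1 h2 h3 h4 => by
    change aeval _ (X i) = _; rw [aeval_X]; simp [h1, h2, h3, h4]
  have hφ'a : φ' (X a) = X a := by change aeval _ (X a) = _; rw [aeval_X]; simp [hab, hac, had, hae]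
  have hφ'b : φ' (X b) = X b - X a := by change aeval _ (X b) = _; rw [aeval_X]; simp
  have hφ'c : φ' (X c) = X c - X a * X b + X a ^ 2 := by
    change aeval _ (X c) = _; rw [aeval_X]; simp [hbc.symm]
  have hφ'd : φ' (X d) = X d - X a * X c + X a ^ 2 * X b - X a ^ 3 := by
    change aeval _ (X d) = _; rw [aeval_X]; simp [hbd.symm, hcd.symm]
  have hφ'e : φ' (X e) = X e - X a * X d + X a ^ 2 * X c - X a ^ 3 * X b + X a ^ 4 := by
    change aeval _ (X e) = _; rw [aeval_X]; simp [hbe.symm, hce.symm, hde.symm]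
  have hφ'i : ∀ i, i ≠ b → i ≠ c → i ≠ d → i ≠ e → φ' (X i) = X i := fun i h1 h2 h3 h4 => by
    change aeval _ (X i) = _; rw [aeval_X]; simp [h1, h2, h3, h4]
  have h₁ : φ.comp φ' = AlgHom.id k (MvPolynomial (Fin n) k) := by
    refine MvPolynomial.algHom_ext fun i => ?_
    rw [AlgHom.comp_apply, AlgHom.id_apply]
    by_cases hib : i = b
    · rw [hib, hφ'b, map_sub, hφb, hφa]; ring
    by_cases hic : i = c
    · rw [hic, hφ'c, map_add, map_sub, map_mul, map_pow, hφc, hφa, hφb]; ring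
    by_cases hid : i = d
    · rw [hid, hφ'd, map_sub, map_add, map_sub, map_mul, map_mul, map_pow, map_pow, hφd, hφa, hφc,
        hφb]; ring
    by_cases hie : i = e
    · rw [hie, hφ'e, map_add, map_sub, map_add, map_sub, map_mul, map_mul, map_mul, map_pow, map_pow,
        map_pow, hφe, hφa, hφd, hφc, hφb]; ring
    · rw [hφ'i i hib hic hid hie, hφi i hib hic hid hie]
  have h₂ : φ'.comp φ = AlgHom.id k (MvPolynomial (Fin n) k) := by
    refine MvPolynomial.algHom_ext fun i => ?_
    rw [AlgHom.comp_apply, AlgHom.id_apply]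
    by_cases hib : i = b
    · rw [hib, hφb, map_add, hφ'b, hφ'a]; ring
    by_cases hic : i = c
    · rw [hic, hφc, map_add, map_mul, hφ'c, hφ'a, hφ'b]; ring
    by_cases hid : i = d
    · rw [hid, hφd, map_add, map_mul, hφ'd, hφ'a, hφ'c]; ring
    by_cases hie : i = e
    · rw [hie, hφe, map_add, map_mul, hφ'e, hφ'a, hφ'd]; ring
    · rw [hφi i hib hic hid hie, hφ'i i hib hic hid hie]
  refine ⟨AlgEquiv.ofAlgHom φ φ' h₁ h₂, ?_, ?_, ?_, ?_, fun i h1 h2 h3 h4 => ?_⟩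
  · exact hφb
  · exact hφc
  · exact hφd
  · exact hφe
  · exact hφi i h1 h2 h3 h4

include hab hac had hae hbc hbd hbe hcd hce hde in
/-- **`ψ₀ ∘ σ = σ_U ∘ ψ₀`**: the root substitution of the `μ₄`-vertex chart intertwines the `J₅`
automorphism `σ` (`x_b ↦ x_b + x_a`, `x_c ↦ x_c + x_b`, `x_d ↦ x_d + x_c`, `x_e ↦ x_e + x_d`, rest
fixed) with the root-chart automorphism `σ_U`; both given by their laws. [OURS · L1 W4.5c] [folklore] -/
theorem aeval_root5_comp_eq (σ σU : MvPolynomial (Fin n) k ≃ₐ[k] MvPolynomial (Fin n) k)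
    (hb : σ (X b) = X b + X a) (hc : σ (X c) = X c + X b) (hd : σ (X d) = X d + X c)
    (he : σ (X e) = X e + X d) (hσ : ∀ i, i ≠ b → i ≠ c → i ≠ d → i ≠ e → σ (X i) = X i)
    (hUb : σU (X b) = X b + X a) (hUc : σU (X c) = X c + X a * X b)
    (hUd : σU (X d) = X d + X a * X c) (hUe : σU (X e) = X e + X a * X d)
    (hσU : ∀ i, i ≠ b → i ≠ c → i ≠ d → i ≠ e → σU (X i) = X i) :
    (aeval (fun i : Fin n => if i = a then X a ^ 4 else if i = b then X a ^ 3 * X b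
        else if i = c then X a ^ 2 * X c else if i = d then X a * X d
        else (X i : MvPolynomial (Fin n) k))).comp
        (σ : MvPolynomial (Fin n) k →ₐ[k] MvPolynomial (Fin n) k) =
      (σU : MvPolynomial (Fin n) k →ₐ[k] MvPolynomial (Fin n) k).comp
        (aeval (fun i : Fin n => if i = a then X a ^ 4 else if i = b then X a ^ 3 * X b
          else if i = c then X a ^ 2 * X c else if i = d then X a * X d
          else (X i : MvPolynomial (Fin n) k))) := by
  have ha : σ (X a) = X a := hσ a hab hac had hae
  have hUa : σU (X a) = X a := hσU a hab hac had hae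
  have hra := root5_X_a k n a b c d
  have hrb := root5_X_b k n a b c d hab
  have hrc := root5_X_c k n a b c d hac hbc
  have hrd := root5_X_d k n a b c d had hbd hcd
  have hri : ∀ i, i ≠ a → i ≠ b → i ≠ c → i ≠ d →
      aeval (fun i : Fin n => if i = a then X a ^ 4 else if i = b then X a ^ 3 * X b
        else if i = c then X a ^ 2 * X c else if i = d then X a * X d
        else (X i : MvPolynomial (Fin n) k)) (X i : MvPolynomial (Fin n) k) = X i := fun i h1 h2 h3 h4 => by
    rw [aeval_X]; simp [h1, h2, h3, h4]
  refine MvPolynomial.algHom_ext fun i => ?_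
  simp only [AlgHom.comp_apply, AlgEquiv.coe_toAlgHom]
  by_cases hib : i = b
  · rw [hib, hb, map_add, hrb, hra, map_mul, map_pow, hUb, hUa]; ring
  by_cases hic : i = c
  · rw [hic, hc, map_add, hrc, hrb, map_mul, map_pow, hUc, hUa]; ring
  by_cases hid : i = d
  · rw [hid, hd, map_add, hrd, hrc, map_mul, hUd, hUa]; ring
  by_cases hie : i = e
  · rw [hie, he, map_add, hri e hae.symm hbe.symm hce.symm hde.symm, hrd, hUe]
  · by_cases hia : i = a
    · rw [hia, ha, hra, map_pow, hUa]
    · rw [hσ i hib hic hid hie, hri i hia hib hic hid, hσU i hib hic hid hie]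

end Summit.ResolutionOfSingularities.ResolutionOfSingularities.Theorems.WildQuotientResolution.JordanFive

end
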